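import Summits.QuantumFields.YangMills.Theorems.BalabanUVNodesN15KingModelSlicesExact
import Summits.QuantumFields.YangMills.Theorems.BalabanUVNodesN15KingModelSlicesExactMass
import Literature.MathematicalPhysics.QuantumFieldTheory.King1986.PropagatorDecayUniform
import Literature.MathematicalPhysics.QuantumFieldTheory.King1986.TorusCongr

/-!
# BalabanUVNodes ∕ N15 — THE KING-MODEL RUNG, CURVED EDITION (PART O-a): THE FULL `A = 0` FLUCTUATION PROPAGATOR
# `G^η_K` OF (2.13) — UNIFORM OFF-DIAGONAL EXPONENTIAL DECAY, by induction on the number of levels `K` (King's (2.17)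
# summed one slice at a time: the peel `G_{K+1} ∘ flatten = L^{d+1}∕L²·(G_K^{sub} + ℋ_KC^{(K)}ℋ_Kᵀ)`)
# (Track A, DAG node N15 = NE2; FAN-OUT v1.1 §N15 s3 «KING-MODEL RUNG … + the one-line statement of what the curved case adds»)

HONEST FRAMING.  Count-neutral kernel bookkeeping (cell `pub-ymgap`, seat `pub-ymgap-dag-n15-e` g6; `--supports stmt-QuantumFields-19912
--as helper` = K3‴ `SpineGivenEndpointR13`, lineage K3 19676 → K3′ 19908).  TEMPLATE LITERATURE, `A = 0`: C. King's scalar U(1)-Higgs MODEL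
on finite tori ([King1986] §2.2 p. 653 (2.13)–(2.17), p. 654 (2.20), Theorem 3.3 p. 658, Prop. 3.7 p. 663, §4 p. 675 (4.42)–(4.44)), NOT
Bałaban's covariant objects; NE2⁺ is NOT PRINTED for those and not proved here; NOT a node discharge; nothing continuum ∕ ℝ⁴ ∕ OS ∕
mass-gap ∕ Clay.  0 `sorry`, 0 `def`, standard axioms.

THE POINT.  Parts F–M of this rung proved NE2's site layer for EVERY SLICE `G^ε_{(j)} = G^ε_{j+1} − G^ε_j` (`j ≥ 1`) of King's
decomposition (2.17) of the `A = 0` fluctuation propagator `G^η_K` (part K `ksSlice_eq_sub`: the slices ARE King's; part M: decay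
`ksSlice_decay_unif` and two-spacing rate `ksSlice_rate_unif` with ONE constant pair for all masses `0 < m² ≤ m₀²`).  What remained
(desk HANDOFF «REMAINS (a)»): the SUM over the slices = the FULL propagator `G^η_K = (L^K)^{d+1}·A₀⁻¹` itself
(`King1986.Torus.constrainedProp`, (2.13)∕(4.44)), its off-diagonal decay UNIFORM IN THE NUMBER OF LEVELS `K` — King's Theorem 3.3 ∕
Prop. 3.7-type statement for the full `A = 0` propagator, which [Ba 4] (1.10) prints in sup-norm form only (a point source costs
`(L^K)^{d+1}`: `King1986/PropagatorDecayUniform`, HONEST SCOPE (ii)).  THIS FILE proves it WITHOUT a telescoped sum, by INDUCTION ON `K`: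
* §1 `mul_tdistT_blockOf_le` — block distances GROW when one level is peeled: `L·|B_L(u) − B_L(v)|_M ≤ |u − v|_{fine L M} + (L − 1)`
  (`UniformDecay.mul_tdistT_blocks_le`);
* §2 **`fullProp_peel`** ∕ `fullProp_peel'` — THE PEEL (K-lit `constrainedProp_succ_flatten` = King's (2.20) one step, + part K
  `ksSlice_eq_sub` = (2.17) one step): for every slice index `i = (e, K, …)` and fine points `x, y` of the nested torus,
  `G(K+1, M_e, L²m²)(flatten x, flatten y) = L^{d+1}∕L²·[G(K, fine L M_e, m²)(x, y) + ksSlice m² i (x, y)]`,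
  `G(K, M, m²) := constrainedProp (L^K) M (aK a L K) ((L^K)²) m²`, `M_e = (2L^e, …, 2L^e)` — the level-`(K+1)` propagator over the
  cube `2L^e` IS (`L^{d−1}` times) the level-`K` propagator over the finer cube `L·2L^e = 2L^{e+1}` at mass `m²∕L²` PLUS the top slice;
  `fullProp_peel_abs_le` (triangle inequality form);
* §3 **`fullProp_decay_unif`** — `∃ C δ > 0, D₀ ≥ 1` (functions of `d, L, a, m₀²`) such that for EVERY `K ≥ 1`, every cube `M_μ = 2L^e`,
  every `0 < m² ≤ m₀²` and all fine `x, y` with `|B(x) − B(y)|_M ≥ D₀`:  `|G(K, M, m²)(x, y)| ≤ C·e^{−δ·|B(x) − B(y)|_M}`.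
  INDUCTION ON `K`: base `K = 1` = [Ba 4] (1.10) with a point source (`King1986.Torus.constrainedProp_decay_blocks_unif`, the factor
  `(L^1)^{d+1}` is a constant); step = the peel at mass `m²∕L² ≤ m² ≤ m₀²`, the induction hypothesis on the finer cube at the finer
  block distance `D_sub ≥ L(D − 1) + 1` (§1 + `blockOf_flatten`), the slice decay `ksSlice_decay_unif` at `D_sub`, and the
  geometric gain: `(2L^{d+1}∕L²)·e^{−δ(L−1)(D−1)} ≤ (2L^{d+1}∕L²)·e^{−2L^{d+1}∕L²} ≤ 1` once `D ≥ D₀ = 1 + (2L^{d+1}∕L²)∕(δ(L−1))`.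
WHY OFF-DIAGONAL ONLY (honest): on the diagonal `G^η_K(x, x)` grows with `K` (the fluctuation field has UV dimension `(d−1)∕2` in
`d + 1 ≥ 3` dimensions); the uniform statement is the off-diagonal one, and the induction never needs the diagonal because peeling
only INCREASES block distances.  The two-spacing rate of the full propagator (paired induction, part M `ksSlice_rate_unif`) is part O-b.
HONEST SCOPE.  (i) `A = 0`, periodic b.c., odd `L ≥ 3`, `0 < m² ≤ m₀²`, cubes `2L^e` (Bałaban's `sitesPerDir`); (ii) LATTICE units of
the level-`K` lattice (as parts F–M; King's (2.20) factor appears as the `L^{d+1}∕L²` of the peel); (iii) `K ≥ 1` levels (`K = 0` is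
the bare `(−Δ + m² + a)⁻¹`, not King's object); (iv) nothing here is Bałaban's `G_k(U)`; not a discharge.
Locators: [King1986] C. King, CMP **102** (1986) 649–677: (2.13)–(2.17) p. 653, (2.20) p. 654, Theorem 3.3 (3.7) p. 658, Prop. 3.7 (3.64)
p. 663, (4.42)–(4.44) p. 675; [Ba 4] = [Balaban1983RegularityDecay] Theorem (1.10) p. 573.
-/

noncomputable section

namespace Summit.QuantumFields.YangMills.BalabanUVNodes.N15KingModelRung.Curved

open Real Finset Matrix
open Literature.MathematicalPhysics.QuantumFieldTheory.Balaban1983to89 (Params)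
open Literature.MathematicalPhysics.QuantumFieldTheory.Balaban1983to89.B5Prop11Plancherel (Tor fine)
open Literature.MathematicalPhysics.QuantumFieldTheory.King1986 (aK aK_pos)
open Literature.MathematicalPhysics.QuantumFieldTheory.King1986.Torus (constrainedProp flatten blockOf tdistT site
  blockOf_flatten mul_tdistT_blocks_le exists_eq_site constrainedProp_succ_flatten tdistT_nonneg
  constrainedProp_decay_blocks_unif)

variable {d : ℕ} (L : ℕ) [NeZero L]

/-! ## §1 Block distances grow when one level is peeled -/

/-- **`L·|B_L(u) − B_L(v)|_M ≤ |u − v|_{fine L M} + (L − 1)`** for sites `u, v` of the once-finer lattice `fine L M` and their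
`L`-blocks in `M`: peeling one level multiplies block distances by `L` up to the block diameter (`UniformDecay.mul_tdistT_blocks_le`
read at the sites' own blocks). [cite: King1986, (2.10) p.653, Prop. 3.7 (3.64) p.663] -/
theorem mul_tdistT_blockOf_le (M : Fin (d + 1) → ℕ) [∀ μ, NeZero (M μ)] (u v : Tor (fine L M)) :
    (L : ℝ) * tdistT M (blockOf L M u) (blockOf L M v) ≤ tdistT (fine L M) u v + ((L : ℝ) - 1) := by
  obtain ⟨j, hj⟩ := exists_eq_site L M u
  obtain ⟨j', hj'⟩ := exists_eq_site L M v
  have h := mul_tdistT_blocks_le L M (blockOf L M u) (blockOf L M v) j j'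
  rw [← hj, ← hj'] at h
  exact h

/-! ## §2 The peel: `G_{K+1} ∘ flatten = L^{d+1}∕L²·(G_K^{sub} + slice)` -/

/-- **THE PEEL** (King's (2.17) one step ∘ (2.20)): for every slice index `i = (e, K = i.j, …)`, `a > 0`, `m² > 0`, `L ≥ 2` and all fine
points `x, y` of the nested torus `Tor (fine L^K (fine L M_e))`, the level-`(K+1)` propagator over the cube `M_e = (2L^e)` at mass `L²m²`,
read at the flattened points, is `L^{d+1}∕L²` times [the level-`K` propagator over the finer cube `fine L M_e` at mass `m²` + the top
slice `ksSlice m² i`]:  `G(K+1, M_e, L²m²)(flatten x, flatten y) = L^{d+1}∕L²·[G(K, fine L M_e, m²)(x, y) + ksSlice(x, y)]`.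
(`constrainedProp_succ_flatten` + `ksSlice_eq_sub`.) [cite: King1986, (2.13)–(2.17) p.653, (2.20) p.654, (4.42) p.675] -/
theorem fullProp_peel (hL : 2 ≤ L) {a m2 : ℝ} (ha : 0 < a) (hm : 0 < m2) (i : KSliceIdx d)
    (x y : Tor (fine (L ^ i.j) (ksU L i))) :
    constrainedProp (L ^ i.j * L) (ksM L i) (aK a L (i.j + 1)) (((L ^ i.j * L : ℕ) : ℝ) ^ 2) ((L : ℝ) ^ 2 * m2)
        (flatten (L ^ i.j) L (ksM L i) x) (flatten (L ^ i.j) L (ksM L i) y)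
      = (L : ℝ) ^ (d + 1) / (L : ℝ) ^ 2 *
          (constrainedProp (L ^ i.j) (ksU L i) (aK a L i.j) (((L ^ i.j : ℕ) : ℝ) ^ 2) m2 x y + ksSlice L a m2 i x y) := by
  rw [constrainedProp_succ_flatten (L ^ i.j) L (ksM L i) ha hL i.one_le_j hm x y, ksSlice_eq_sub L hL ha hm i x y]
  ring

/-- **The peel with the mass on the left arbitrary**: `G(K+1, M_e, m²)(flatten x, flatten y) = L^{d+1}∕L²·[G(K, fine L M_e, m²∕L²)(x, y) +
ksSlice (m²∕L²) i (x, y)]` — the sub-propagator and the slice carry the mass `m²∕L²` (King's (2.20): the mass of scale `j` is `m²(L^jη)²`).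
[cite: King1986, (2.17) p.653, (2.20) p.654] -/
theorem fullProp_peel' (hL : 2 ≤ L) {a msq : ℝ} (ha : 0 < a) (hm : 0 < msq) (i : KSliceIdx d)
    (x y : Tor (fine (L ^ i.j) (ksU L i))) :
    constrainedProp (L ^ i.j * L) (ksM L i) (aK a L (i.j + 1)) (((L ^ i.j * L : ℕ) : ℝ) ^ 2) msq
        (flatten (L ^ i.j) L (ksM L i) x) (flatten (L ^ i.j) L (ksM L i) y)
      = (L : ℝ) ^ (d + 1) / (L : ℝ) ^ 2 *
          (constrainedProp (L ^ i.j) (ksU L i) (aK a L i.j) (((L ^ i.j : ℕ) : ℝ) ^ 2) (msq / (L : ℝ) ^ 2) x y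
            + ksSlice L a (msq / (L : ℝ) ^ 2) i x y) := by
  have hL0 : (0 : ℝ) < L := by exact_mod_cast (show 0 < L by omega)
  have hL2 : (L : ℝ) ^ 2 ≠ 0 := pow_ne_zero _ hL0.ne'
  have h := fullProp_peel L hL ha (m2 := msq / (L : ℝ) ^ 2) (by positivity) i x y
  rw [mul_div_cancel₀ msq hL2] at h
  exact h

/-- **The peel, triangle-inequality form**: `|G(K+1, M_e, m²)(flatten x, flatten y)| ≤ L^{d+1}∕L²·(|G(K, fine L M_e, m²∕L²)(x, y)| +
|ksSlice (m²∕L²) i (x, y)|)`. [cite: King1986, (2.17) p.653, (2.20) p.654] -/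
theorem fullProp_peel_abs_le (hL : 2 ≤ L) {a msq : ℝ} (ha : 0 < a) (hm : 0 < msq) (i : KSliceIdx d)
    (x y : Tor (fine (L ^ i.j) (ksU L i))) :
    |constrainedProp (L ^ i.j * L) (ksM L i) (aK a L (i.j + 1)) (((L ^ i.j * L : ℕ) : ℝ) ^ 2) msq
        (flatten (L ^ i.j) L (ksM L i) x) (flatten (L ^ i.j) L (ksM L i) y)|
      ≤ (L : ℝ) ^ (d + 1) / (L : ℝ) ^ 2 *
          (|constrainedProp (L ^ i.j) (ksU L i) (aK a L i.j) (((L ^ i.j : ℕ) : ℝ) ^ 2) (msq / (L : ℝ) ^ 2) x y|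
            + |ksSlice L a (msq / (L : ℝ) ^ 2) i x y|) := by
  have hΛ : 0 ≤ (L : ℝ) ^ (d + 1) / (L : ℝ) ^ 2 := by positivity
  rw [fullProp_peel' L hL ha hm i x y, abs_mul, abs_of_nonneg hΛ]
  exact mul_le_mul_of_nonneg_left (abs_add_le _ _) hΛ

/-! ## §3 The uniform off-diagonal decay of the full propagator -/

/-- **UNIFORM OFF-DIAGONAL EXPONENTIAL DECAY OF KING'S FULL `A = 0` FLUCTUATION PROPAGATOR `G^η_K`** (the covariance of the
constrained Gaussian (2.13), `King1986.Torus.constrainedProp (L^K) M (aK a L K) ((L^K)²) m² = (L^K)^{d+1}·A₀⁻¹`, level-`K` lattice units):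
for odd `L ≥ 3`, `a > 0` and a mass cap `m₀² ≥ 0` there are `C, δ > 0` and `D₀ ≥ 1` (functions of `d, L, a, m₀²`) such that for EVERY number
of levels `K ≥ 1`, every cube `M_μ = 2L^e`, every mass `0 < m² ≤ m₀²` and all fine points `x, y` whose unit blocks are at torus distance
`|B(x) − B(y)|_M ≥ D₀`:  `|G^η_K(x, y)| ≤ C·e^{−δ·|B(x) − B(y)|_M}` — King's Theorem 3.3 ∕ Prop. 3.7-type decay for the FULL propagator,
uniform in `K`, by induction on `K` (peel §2 + part M's slice decay + [Ba 4] (1.10) at the bottom; see the module docstring for the gain).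
The number of fine points per block is quantified as any spelling `N = L^K` (e.g. `L^n·L^k`, the tree's idiom of `MinimizerBlockDecay`).
[cite: King1986, (2.13)–(2.17) p.653, (2.20) p.654, Theorem 3.3 (3.7) p.658, Prop. 3.7 (3.64) p.663, (4.42)–(4.44) p.675; Balaban1983RegularityDecay, Theorem (1.10) p.573] -/
theorem fullProp_decay_unif (hLodd : Odd L) (hL : 2 ≤ L) {a : ℝ} (ha : 0 < a) {m0sq : ℝ} (hm0 : 0 ≤ m0sq) :
    ∃ C δ D₀ : ℝ, 0 < C ∧ 0 < δ ∧ 1 ≤ D₀ ∧ ∀ (K : ℕ), 1 ≤ K → ∀ (N : ℕ) [NeZero N], N = L ^ K →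
      ∀ (e : ℕ) (M : Fin (d + 1) → ℕ) [∀ μ, NeZero (M μ)], (∀ μ, M μ = 2 * L ^ e) →
      ∀ (msq : ℝ), 0 < msq → msq ≤ m0sq →
      ∀ x y : Tor (fine N M), D₀ ≤ tdistT M (blockOf N M x) (blockOf N M y) →
        |constrainedProp N M (aK a L K) (((N : ℕ) : ℝ) ^ 2) msq x y|
          ≤ C * Real.exp (-(δ * tdistT M (blockOf N M x) (blockOf N M y))) := by
  have hL1 : 1 < L := by omega
  have hL0 : (0 : ℝ) < L := by exact_mod_cast (show 0 < L by omega)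
  have hLm1 : (1 : ℝ) ≤ (L : ℝ) - 1 := by
    have : (2 : ℝ) ≤ L := by exact_mod_cast hL
    linarith
  -- the base constants ([Ba 4] (1.10), point source) and the slice constants (part M)
  obtain ⟨δb, cb, hδb, hcb, Hb⟩ := constrainedProp_decay_blocks_unif (d + 1) L (by omega) ⟨hLodd, hL1⟩ ha hm0
  obtain ⟨Cs, κ, hCs, hκ, Hs⟩ := ksSlice_decay_unif (d := d) L hLodd hL ha hm0
  -- the constants of the theorem
  set Λ : ℝ := (L : ℝ) ^ (d + 1) / (L : ℝ) ^ 2 with hΛdef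
  have hΛ : 0 < Λ := by positivity
  set δ : ℝ := min δb κ with hδdef
  have hδ : 0 < δ := lt_min hδb hκ
  have hδb' : δ ≤ δb := min_le_left _ _
  have hδκ : δ ≤ κ := min_le_right _ _
  set C : ℝ := max ((L : ℝ) ^ (d + 1) * cb) Cs with hCdef
  have hC : 0 < C := lt_max_of_lt_right hCs
  have hCb : (L : ℝ) ^ (d + 1) * cb ≤ C := le_max_left _ _
  have hCsC : Cs ≤ C := le_max_right _ _
  set A : ℝ := 2 * Λ with hAdef
  have hA : 0 < A := by positivity
  set D₀ : ℝ := 1 + A / (δ * ((L : ℝ) - 1)) with hD₀def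
  have hD₀1 : 1 ≤ D₀ := by
    have : 0 ≤ A / (δ * ((L : ℝ) - 1)) := by positivity
    linarith
  refine ⟨C, δ, D₀, hC, hδ, hD₀1, ?_⟩
  intro K hK
  induction K, hK using Nat.le_induction with
  | base =>
    -- `K = 1`: (1.10) with a point source; the factor `(L^1)^{d+1}` is a constant
    intro N _ hN e M _ hM msq hmsq hcap x y _hD
    subst hN
    set P : Params := ⟨d + 1, L, e, 1, by omega, ⟨hLodd, hL1⟩⟩ with hPdef
    have hMK : ∀ μ, M μ = P.sitesPerDir P.K := fun μ => by
      rw [hM μ]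
      simp [hPdef, Params.sitesPerDir]
    have h := Hb P rfl rfl le_rfl msq hmsq.le hcap M hMK (L ^ 1) rfl x y
    have hcast : (((L ^ 1 : ℕ) : ℝ)) ^ P.d * cb = (L : ℝ) ^ (d + 1) * cb := by
      simp [hPdef]
    rw [hcast] at h
    have hDnn := tdistT_nonneg M (blockOf (L ^ 1) M x) (blockOf (L ^ 1) M y)
    have hexp : Real.exp (-(δb * tdistT M (blockOf (L ^ 1) M x) (blockOf (L ^ 1) M y)))
        ≤ Real.exp (-(δ * tdistT M (blockOf (L ^ 1) M x) (blockOf (L ^ 1) M y))) :=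
      Real.exp_le_exp.mpr (neg_le_neg (mul_le_mul_of_nonneg_right hδb' hDnn))
    calc |constrainedProp (L ^ 1) M (aK a L 1) (((L ^ 1 : ℕ) : ℝ) ^ 2) msq x y|
        ≤ (L : ℝ) ^ (d + 1) * cb * Real.exp (-(δb * tdistT M (blockOf (L ^ 1) M x) (blockOf (L ^ 1) M y))) := h
      _ ≤ C * Real.exp (-(δ * tdistT M (blockOf (L ^ 1) M x) (blockOf (L ^ 1) M y))) :=
          mul_le_mul hCb hexp (Real.exp_pos _).le hC.le
  | succ K hK IH =>
    intro N _ hN e M _ hM msq hmsq hcap x' y' hD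
    subst hN
    -- the unit lattice IS the cube `M_e`
    obtain rfl : M = fun _ => 2 * L ^ e := funext hM
    -- the slice index of the peeled top slice and the nested coordinates of the two points
    set i : KSliceIdx d := ⟨e, K, hK, 1, le_rfl, 0, Nat.zero_le e, 1, le_rfl⟩ with hidef
    obtain ⟨x, rfl⟩ := (flatten (L ^ K) L (ksM L i)).surjective x'
    obtain ⟨y, rfl⟩ := (flatten (L ^ K) L (ksM L i)).surjective y'
    -- the two block distances: `D` (level `K+1`, cube `M_e`) and `Dsub` (level `K`, cube `fine L M_e`)
    set D : ℝ := tdistT (fun _ : Fin (d + 1) => 2 * L ^ e) (blockOf (L ^ (K + 1)) (fun _ : Fin (d + 1) => 2 * L ^ e)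
        (flatten (L ^ K) L (ksM L i) x)) (blockOf (L ^ (K + 1)) (fun _ : Fin (d + 1) => 2 * L ^ e)
        (flatten (L ^ K) L (ksM L i) y)) with hDdef
    set Dsub : ℝ := tdistT (ksU L i) (blockOf (L ^ K) (ksU L i) x) (blockOf (L ^ K) (ksU L i) y) with hDsubdef
    have hBx : blockOf (L ^ (K + 1)) (fun _ : Fin (d + 1) => 2 * L ^ e) (flatten (L ^ K) L (ksM L i) x)
        = blockOf L (ksM L i) (blockOf (L ^ K) (ksU L i) x) := blockOf_flatten (L ^ K) L (ksM L i) x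
    have hBy : blockOf (L ^ (K + 1)) (fun _ : Fin (d + 1) => 2 * L ^ e) (flatten (L ^ K) L (ksM L i) y)
        = blockOf L (ksM L i) (blockOf (L ^ K) (ksU L i) y) := blockOf_flatten (L ^ K) L (ksM L i) y
    have hgrow : (L : ℝ) * D ≤ Dsub + ((L : ℝ) - 1) := by
      rw [hDdef, hBx, hBy]
      exact mul_tdistT_blockOf_le L (ksM L i) (blockOf (L ^ K) (ksU L i) x) (blockOf (L ^ K) (ksU L i) y)
    have hD₀D : D₀ ≤ D := hD
    have hDsub_ge : (L : ℝ) * (D - 1) + 1 ≤ Dsub := by linarith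
    have hprod : 0 ≤ ((L : ℝ) - 1) * (D - 1) := mul_nonneg (by linarith) (by linarith)
    have hDsub_D₀ : D₀ ≤ Dsub := by linarith
    -- the mass one level down
    have hL2 : (0 : ℝ) < (L : ℝ) ^ 2 := by positivity
    have hm2 : 0 < msq / (L : ℝ) ^ 2 := div_pos hmsq hL2
    have hm2cap : msq / (L : ℝ) ^ 2 ≤ m0sq := by
      have h1 : (1 : ℝ) ≤ (L : ℝ) ^ 2 := one_le_pow₀ (by exact_mod_cast (show 1 ≤ L by omega))
      exact (div_le_self hmsq.le h1).trans hcap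
    -- the induction hypothesis on the finer cube `fine L M_e = (2L^{e+1})`
    have hM' : ∀ μ, ksU L i μ = 2 * L ^ (e + 1) := fun μ => by
      show L * (2 * L ^ e) = 2 * L ^ (e + 1)
      ring
    have hIH := IH (L ^ K) rfl (e + 1) (ksU L i) hM' (msq / (L : ℝ) ^ 2) hm2 hm2cap x y hDsub_D₀
    -- the slice decay at the finer block distance
    have hS : |ksSlice L a (msq / (L : ℝ) ^ 2) i x y| ≤ Cs * Real.exp (-(κ * Dsub)) :=
      (Hs (msq / (L : ℝ) ^ 2) hm2 hm2cap i).1 x y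
    have hDsub0 : 0 ≤ Dsub := tdistT_nonneg _ _ _
    have hS' : |ksSlice L a (msq / (L : ℝ) ^ 2) i x y| ≤ C * Real.exp (-(δ * Dsub)) :=
      hS.trans (mul_le_mul hCsC (Real.exp_le_exp.mpr (neg_le_neg (mul_le_mul_of_nonneg_right hδκ hDsub0)))
        (Real.exp_pos _).le hC.le)
    -- the peel
    have hpeel := fullProp_peel_abs_le L hL ha hmsq i x y
    -- the gain: `A·C·e^{−δ·Dsub} ≤ C·e^{−δ·D}`
    have hgainD : A ≤ δ * (((L : ℝ) - 1) * (D - 1)) := by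
      have h1 : A / (δ * ((L : ℝ) - 1)) ≤ D - 1 := by linarith
      have h2 : 0 < δ * ((L : ℝ) - 1) := by positivity
      calc A ≤ (D - 1) * (δ * ((L : ℝ) - 1)) := (div_le_iff₀ h2).mp h1
        _ = δ * (((L : ℝ) - 1) * (D - 1)) := by ring
    have hexp : Real.exp (-(δ * Dsub)) ≤ Real.exp (-(δ * D)) * Real.exp (-A) := by
      rw [← Real.exp_add]
      apply Real.exp_le_exp.mpr
      have h1 : δ * ((L : ℝ) * (D - 1) + 1) ≤ δ * Dsub := mul_le_mul_of_nonneg_left hDsub_ge hδ.le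
      have h2 : δ * ((L : ℝ) * (D - 1) + 1) = δ * (((L : ℝ) - 1) * (D - 1)) + δ * D := by ring
      linarith
    -- `A·e^{−A} ≤ 1` (`A ≤ 1 + A ≤ e^A`; the tree's `Regulariser.mul_exp_neg_le_one`, inlined to keep the imports physical)
    have hAexp : A * Real.exp (-A) ≤ 1 := by
      have h1 : A ≤ Real.exp A := by linarith [Real.add_one_le_exp A]
      rw [Real.exp_neg, ← div_eq_mul_inv, div_le_one (Real.exp_pos A)]
      exact h1
    have hgain : A * C * Real.exp (-(δ * Dsub)) ≤ C * Real.exp (-(δ * D)) := by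
      calc A * C * Real.exp (-(δ * Dsub)) ≤ A * C * (Real.exp (-(δ * D)) * Real.exp (-A)) :=
            mul_le_mul_of_nonneg_left hexp (by positivity)
        _ = C * Real.exp (-(δ * D)) * (A * Real.exp (-A)) := by ring
        _ ≤ C * Real.exp (-(δ * D)) * 1 :=
            mul_le_mul_of_nonneg_left hAexp (by positivity)
        _ = C * Real.exp (-(δ * D)) := mul_one _
    -- assemble
    calc |constrainedProp (L ^ (K + 1)) (fun _ : Fin (d + 1) => 2 * L ^ e) (aK a L (K + 1))
            (((L ^ (K + 1) : ℕ) : ℝ) ^ 2) msq (flatten (L ^ K) L (ksM L i) x) (flatten (L ^ K) L (ksM L i) y)|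
        ≤ Λ * (|constrainedProp (L ^ K) (ksU L i) (aK a L K) (((L ^ K : ℕ) : ℝ) ^ 2) (msq / (L : ℝ) ^ 2) x y|
            + |ksSlice L a (msq / (L : ℝ) ^ 2) i x y|) := hpeel
      _ ≤ Λ * (C * Real.exp (-(δ * Dsub)) + C * Real.exp (-(δ * Dsub))) :=
          mul_le_mul_of_nonneg_left (add_le_add hIH hS') hΛ.le
      _ = A * C * Real.exp (-(δ * Dsub)) := by rw [hAdef]; ring
      _ ≤ C * Real.exp (-(δ * D)) := hgain

end Summit.QuantumFields.YangMills.BalabanUVNodes.N15KingModelRung.Curved
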